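import Summits.AtomisticToContinuum.Crystallization.Theorems.ExcessDecayLiouvillePhononStabilityDefs
import Summits.AtomisticToContinuum.Crystallization.Theorems.ExcessDecayLiouvillePhononStabilityLabels

/-!
# `PhononStability` (stmt-AtomisticToContinuum-9333), line `contragredient-window-collapse`: stub `stub_latticeSum`

Reduction S0 of the line (pure reference-lattice analysis; no Lennard-Jones physics, no window): for every
finitely supported label field `w : Label → ℝ³` the lattice sum
`Σ_c ‖ζ⁰_c‖⁻⁸ · Σ_k ‖Δ_c w k‖²` over the ordered bond classes `c = (m, m', n)` converges (`LatticeSum`, i.e.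
`LatticeSummable w`).  Two ingredients:

* the uniform bound `Σ_k ‖Δ_c w k‖² ≤ 4 Σ_ℓ ‖w ℓ‖²` (`‖a − b‖² ≤ 2‖a‖² + 2‖b‖²`, and the two finitely supported
  families `k ↦ ‖w (m', k + n)‖²`, `k ↦ ‖w (m, k)‖²` are re-indexings of `ℓ ↦ ‖w ℓ‖²` along injections);
* `Σ_n ‖latVec n − y‖⁻⁸ < ∞` for every `y ∈ ℝ³`: Mathlib's `ZLattice.summable_norm_sub_inv_pow` on the rank-3
  period lattice `ℤu + ℤv + ℤ·2√(2/3)e₃`, realised as the tree's `barlowPeriodLattice` of the alternating Hägg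
  sequence with `a = 1`, `h = √(2/3)`, period `2`, pulled back along the injection `n ↦ latVec n`; the reference
  bond vector of class `(m, m', n)` is `latVec n − y_{m,m'}` with a shift depending only on the sublattice pair.

Then `0 ≤ ‖ζ⁰_c‖⁻⁸ · Σ_k ‖Δ_c w k‖² ≤ 4(Σ_ℓ ‖w ℓ‖²) · ‖ζ⁰_c‖⁻⁸` is dominated by a summable family.  All `[folklore]`.
-/

noncomputable section

open scoped BigOperators Classical InnerProductSpace
open Filter Set Function
open Literature.MathematicalPhysics.StatisticalMechanics
open Summit.AtomisticToContinuum.Crystallization.Theses.ExcessDecayLiouville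
open Summit.AtomisticToContinuum.Crystallization.Theorems.PhononStabilityNegative
open Summit.AtomisticToContinuum.Crystallization.Theorems.PhononStabilityCWC

namespace Summit.AtomisticToContinuum.Crystallization.Theorems.PhononStabilityCWC.LatticeSumStub


/-! ## The uniform bound on the metric-free class functionals -/

/-- `‖a − b‖² ≤ 2‖a‖² + 2‖b‖²`. [folklore] -/
private theorem norm_sub_sq_le (a b : (EuclideanSpace ℝ (Fin 3))) : ‖a - b‖ ^ 2 ≤ 2 * ‖a‖ ^ 2 + 2 * ‖b‖ ^ 2 := by
  nlinarith [norm_sub_le a b, norm_nonneg (a - b), norm_nonneg a, norm_nonneg b,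
    sq_nonneg (‖a‖ - ‖b‖)]

/-- The squared-norm field `ℓ ↦ ‖w ℓ‖²` of a finitely supported label field is summable. [folklore] -/
private theorem summable_norm_sq {w : Label → (EuclideanSpace ℝ (Fin 3))} (hw : (Function.support w).Finite) :
    Summable fun ℓ => ‖w ℓ‖ ^ 2 := by
  refine summable_of_hasFiniteSupport (hw.subset fun ℓ hℓ => ?_)
  rw [Function.mem_support] at hℓ ⊢
  intro h0
  apply hℓ
  rw [h0, norm_zero]
  norm_num

/-- `Σ_k ‖Δ_c w k‖² ≥ 0`. [folklore] -/
private theorem plainForm_nonneg' (c : BondClass) (w : Label → (EuclideanSpace ℝ (Fin 3))) : 0 ≤ plainForm c w :=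
  tsum_nonneg fun _ => by positivity

/-- **Uniform bound:** `Σ_k ‖Δ_c w k‖² ≤ 4 Σ_ℓ ‖w ℓ‖²` for every class `c` and every finitely supported `w`.
[folklore] -/
theorem plainForm_le {w : Label → (EuclideanSpace ℝ (Fin 3))} (hw : (Function.support w).Finite) (c : BondClass) :
    plainForm c w ≤ 4 * ∑' ℓ, ‖w ℓ‖ ^ 2 := by
  obtain ⟨m, m', n⟩ := c
  have hFs := summable_norm_sq hw
  have hF0 : ∀ ℓ : Label, 0 ≤ ‖w ℓ‖ ^ 2 := fun ℓ => by positivity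
  have hi1 : Function.Injective fun k : Fin 3 → ℤ => ((m', k + n) : Label) := by
    intro k k' h
    simpa using h
  have hi2 : Function.Injective fun k : Fin 3 → ℤ => ((m, k) : Label) := by
    intro k k' h
    simpa using h
  have h1 : Summable fun k : Fin 3 → ℤ => ‖w (m', k + n)‖ ^ 2 := by
    simpa only [Function.comp_def] using hFs.comp_injective hi1
  have h2 : Summable fun k : Fin 3 → ℤ => ‖w (m, k)‖ ^ 2 := by
    simpa only [Function.comp_def] using hFs.comp_injective hi2
  have h1le : ∑' k : Fin 3 → ℤ, ‖w (m', k + n)‖ ^ 2 ≤ ∑' ℓ, ‖w ℓ‖ ^ 2 := by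
    simpa only [Function.comp_def] using tsum_comp_le_tsum_of_inj hFs hF0 hi1
  have h2le : ∑' k : Fin 3 → ℤ, ‖w (m, k)‖ ^ 2 ≤ ∑' ℓ, ‖w ℓ‖ ^ 2 := by
    simpa only [Function.comp_def] using tsum_comp_le_tsum_of_inj hFs hF0 hi2
  have hterm : ∀ k : Fin 3 → ℤ,
      ‖bondDiff (m, m', n) w k‖ ^ 2 ≤ 2 * ‖w (m', k + n)‖ ^ 2 + 2 * ‖w (m, k)‖ ^ 2 := fun k =>
    norm_sub_sq_le (w (m', k + n)) (w (m, k))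
  have hrhs : Summable fun k : Fin 3 → ℤ => 2 * ‖w (m', k + n)‖ ^ 2 + 2 * ‖w (m, k)‖ ^ 2 :=
    (h1.mul_left 2).add (h2.mul_left 2)
  have hlhs : Summable fun k : Fin 3 → ℤ => ‖bondDiff (m, m', n) w k‖ ^ 2 :=
    Summable.of_nonneg_of_le (fun k => by positivity) hterm hrhs
  calc plainForm (m, m', n) w
      ≤ ∑' k : Fin 3 → ℤ, (2 * ‖w (m', k + n)‖ ^ 2 + 2 * ‖w (m, k)‖ ^ 2) :=
        hlhs.tsum_le_tsum hterm hrhs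
    _ = 2 * ∑' k : Fin 3 → ℤ, ‖w (m', k + n)‖ ^ 2 + 2 * ∑' k : Fin 3 → ℤ, ‖w (m, k)‖ ^ 2 := by
        rw [(h1.mul_left 2).tsum_add (h2.mul_left 2), tsum_mul_left, tsum_mul_left]
    _ ≤ 4 * ∑' ℓ, ‖w ℓ‖ ^ 2 := by linarith

/-! ## The lattice sum `Σ_n ‖latVec n − y‖⁻⁸` -/

/-- `latVec n` is the integer combination `n₀u + n₁v + n₂t` of the period vectors of the tree's Barlow period
lattice of the alternating Hägg sequence with `a = 1`, `h = √(2/3)`, period `2` (its third period vector is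
`W·w + 2·√(2/3)e₃ = genC`, the window sum `W = 1 + (−1)` being `0`). [folklore] -/
private theorem latVec_eq (n : Fin 3 → ℤ) :
    latVec n = (n 0 : ℝ) • triangularVec₁ 1 + (n 1 : ℝ) • triangularVec₂ 1 +
      (n 2 : ℝ) • ((haggWindow alternatingHagg 0 2 : ℝ) • barlowOffset 1 +
        ((2 : ℕ) : ℝ) • layerNormal (Real.sqrt (2 / 3))) := by
  have hW : haggWindow alternatingHagg 0 2 = 0 := by
    rw [haggWindow_alternating, if_pos even_two]
  rw [hW]
  ext i
  fin_cases i <;> simp [latVec, genU, genV, genC, triangularVec₁, triangularVec₂, barlowOffset,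
    layerNormal]

/-- **The lattice sum:** `Σ_n ‖latVec n − y‖⁻⁸ < ∞` for every `y ∈ ℝ³` (Mathlib's
`ZLattice.summable_norm_sub_inv_pow` on the rank-3 period lattice, pulled back along `n ↦ latVec n`). [folklore] -/
theorem summable_latVec_sub_inv_pow (y : (EuclideanSpace ℝ (Fin 3))) :
    Summable fun n : Fin 3 → ℤ => ‖latVec n - y‖⁻¹ ^ 8 := by
  have ha : (1 : ℝ) ≠ 0 := one_ne_zero
  have hh : Real.sqrt (2 / 3) ≠ 0 := by positivity
  have hp : (2 : ℕ) ≠ 0 := two_ne_zero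
  haveI : DiscreteTopology (barlowPeriodLattice alternatingHagg ha hh hp) := by
    unfold barlowPeriodLattice; infer_instance
  haveI : IsZLattice ℝ (barlowPeriodLattice alternatingHagg ha hh hp) := by
    unfold barlowPeriodLattice; infer_instance
  have hrank : Module.finrank ℤ (barlowPeriodLattice alternatingHagg ha hh hp) = 3 := by
    rw [ZLattice.rank ℝ (barlowPeriodLattice alternatingHagg ha hh hp), finrank_euclideanSpace,
      Fintype.card_fin]
  have hs : Summable fun z : barlowPeriodLattice alternatingHagg ha hh hp => ‖(z : (EuclideanSpace ℝ (Fin 3))) - y‖⁻¹ ^ 8 :=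
    ZLattice.summable_norm_sub_inv_pow _ 8 (by rw [hrank]; norm_num) y
  have hmem : ∀ n : Fin 3 → ℤ, latVec n ∈ barlowPeriodLattice alternatingHagg ha hh hp := fun n => by
    rw [latVec_eq]
    exact sum_smul_mem_barlowPeriodLattice alternatingHagg ha hh hp (n 0) (n 1) (n 2)
  have hinj : Function.Injective fun n : Fin 3 → ℤ =>
      (⟨latVec n, hmem n⟩ : barlowPeriodLattice alternatingHagg ha hh hp) :=
    fun n n' h => LabelsStub.latVec_injective (congrArg Subtype.val h)
  simpa only [Function.comp_def] using hs.comp_injective hinj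

/-! ## The lattice sum over bond classes -/

/-- The reference bond vector of class `(m, m', n)` is `latVec n` minus a shift depending only on `(m, m')`.
[folklore] -/
private theorem bondVec_zero_eq (m m' : Fin 2) :
    ∃ y : (EuclideanSpace ℝ (Fin 3)), ∀ n : Fin 3 → ℤ, bondVec 0 (m, m', n) = latVec n - y :=
  ⟨refPos 0 (m, 0) - (if m' = 1 then innerRef + 0 else 0), fun n => by
    simp only [bondVec, refPos]
    abel⟩

/-- `Σ_c ‖ζ⁰_c‖⁻⁸ < ∞` over all ordered bond classes (four shifted copies of the rank-3 lattice sum; the diagonal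
class contributes the junk value `(0⁻¹)⁸ = 0`). [folklore] -/
theorem summable_inv_pow_bondVec : Summable fun c : BondClass => ‖bondVec 0 c‖⁻¹ ^ 8 := by
  have hnn : 0 ≤ fun c : BondClass => ‖bondVec 0 c‖⁻¹ ^ 8 := fun c => by positivity
  refine (summable_prod_of_nonneg hnn).2 ⟨fun m => ?_, .of_finite⟩
  have hnn' : 0 ≤ fun c : Fin 2 × (Fin 3 → ℤ) => ‖bondVec 0 (m, c)‖⁻¹ ^ 8 := fun c => by positivity
  refine (summable_prod_of_nonneg hnn').2 ⟨fun m' => ?_, .of_finite⟩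
  obtain ⟨y, hy⟩ := bondVec_zero_eq m m'
  refine (summable_latVec_sub_inv_pow y).congr fun n => ?_
  show ‖latVec n - y‖⁻¹ ^ 8 = ‖bondVec 0 (m, m', n)‖⁻¹ ^ 8
  rw [hy]

/-! ## The stub -/

/-- **S0 — lattice sum (`stub_latticeSum`).** For a finitely supported label field `w` the lattice sum
`Σ_c ‖ζ⁰_c‖⁻⁸ · Σ_k ‖Δ_c w k‖²` converges: `0 ≤ term_c ≤ 4(Σ_ℓ ‖w ℓ‖²)·‖ζ⁰_c‖⁻⁸` and `Σ_c ‖ζ⁰_c‖⁻⁸ < ∞`.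
[folklore] -/
theorem stub_latticeSum : LatticeSum := by
  intro w hw
  unfold LatticeSummable
  refine Summable.of_nonneg_of_le (fun c => mul_nonneg (by positivity) (plainForm_nonneg' c w))
    (fun c => ?_) (summable_inv_pow_bondVec.mul_left (4 * ∑' ℓ, ‖w ℓ‖ ^ 2))
  calc ‖bondVec 0 c‖⁻¹ ^ 8 * plainForm c w ≤ ‖bondVec 0 c‖⁻¹ ^ 8 * (4 * ∑' ℓ, ‖w ℓ‖ ^ 2) :=
        mul_le_mul_of_nonneg_left (plainForm_le hw c) (by positivity)
    _ = 4 * (∑' ℓ, ‖w ℓ‖ ^ 2) * ‖bondVec 0 c‖⁻¹ ^ 8 := by ring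

end Summit.AtomisticToContinuum.Crystallization.Theorems.PhononStabilityCWC.LatticeSumStub

end
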